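import Literature.NumberTheory.Automorphic.IsomorphismGraphGroup
import Literature.NumberTheory.Automorphic.ChevalleyGroupAdjoint
import HarnessLib

/-!
# The Lie algebra of the graph subgroup, I: generators, weights, and the normaliser
(trunk T-AUTOMORPHIC, G25 AutomorphicL; step 3 of the graph proof of `chevalley_isomorphism_abstract`)

Continuation of `IsomorphismGraphGroup.lean` (namespace `Literature.NumberTheory.Automorphic`).
For two pairs `(G, T) ≤ GL_n`, `(G', T') ≤ GL_{n'}` with the same root datum `P`
(`h : IsRootDatumOf G T P eX eY`, `h' : IsRootDatumOf G' T' P eX' eY'`) that file built, inside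
`G × G' = prodBlock G G' ≤ GL (n ⊕ n')`, the graph torus `T̃ = {diag(t, f_T t)}`, the diagonal
root homomorphisms `ũ_i(x) = diag(u_i(x), u'_i(x))`, `ṽ_i`, and the graph group
`H_S = ⟨T̃, Ũ_i, Ṽ_i : i ∈ S⟩` (Humphreys, *Linear Algebraic Groups*, §33). Here we set up its
infinitesimal study (characteristic `0`, Springer, *Linear Algebraic Groups*, 2nd ed., 4.4):

* **diagonal root vectors** `ẽ_i = diag(e_i, e'_i)` (`graphE`), `f̃_i = diag(f_i, f'_i)`
  (`graphF`), `h̃_i = diag(h_i, h'_i)` (`graphHc`) built from the `𝔰𝔩₂`-triples of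
  `RootSl2Triples.lean`; their brackets are computed blockwise (`lie_graphE_graphF`,
  `lie_graphHc_graphE`, `lie_graphHc_graphF`); `ẽ_i` is the velocity of `ũ_i`
  (`velocity_graphUpper`, through the new identification `velocity (φ ∘ u⁺) = dφ E`,
  `IsRootDatumOf.velocity_rootSL2_upper`, Springer 4.4.9), hence `ẽ_i ∈ Lie(Ũ_i) ⊆ Lie(H_S)`,
  `ẽ_i` is a `T̃`-weight vector of weight `χ̃_{α_i}`, nilpotent, and
  **`ũ_i(x) = exp (x ẽ_i)`** (`graphUpperGL_eq_expHom`, `IsRootHom.coe_apply_eq_exp`);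
  likewise for `f̃_i`, `ṽ_i`; and **`h̃_i ∈ Lie(T̃)`** (`graphHc_mem_lieAlgebraGL_graphTorus`: it
  is the velocity of the cocharacter `t ↦ diag(α_i^∨ t, α_i'^∨ t)` of `T̃`, blockwise the Laurent
  velocity `dφ_i H` of `LaurentCurveTangent.lean`);
* **the Lie algebra of the graph torus is a graph** (`eq_of_mem_lieAlgebraGL_graphTorus_of_toBlocks₁₁_eq`
  and `…toBlocks₂₂_eq`): an element of `Lie(T̃)` is determined by either of its diagonal blocks —
  the coordinates of `f_T` (resp. `f_T⁻¹`) are polynomials in those of the other block, and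
  differentiating the resulting equations of `T̃` at `1` expresses one block linearly through the
  other (`tangentDeriv_aeval_fstCoordPoly`);
* **weights of `T̃`**: a block-diagonal matrix `diag(B, B')` is a weight vector of weight `χ̃_x`
  iff `B ∈ (𝔤𝔩_n)_{χ_x}` and `B' ∈ (𝔤𝔩_{n'})_{χ'_x}` (`fromBlocks_mem_weightSpaceGL_graphTorus_iff`);
  combined with `Lie(H_S) ⊆ Lie(G) ⊕ Lie(G')` (`BlockDiagonalGL.lean`) and the root-space
  structure of `Lie(G)`, `Lie(G')` in characteristic `0` (`RootSl2Triples.lean`: `𝔤_{α_i} = k e_i`,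
  `𝔤_0 = Lie(T)`, `𝔤_x = 0` otherwise) this pins the weight vectors of `Lie(H_S)`:
  `mem_lieAlgebraGL_graphGroup_weight_root` (`diag(a e_i, a' e'_i)`), `…_weight_zero`
  (`diag(z, z')`, `z ∈ Lie T`, `z' ∈ Lie T'`), `…_weight_eq_zero` (zero for non-roots `x ≠ 0`);
* **the normaliser trick** (Springer 4.4.15 / 10.2.8, as in `ChevalleyGroupBasic.lean`): the Lie
  subalgebra `𝔡_S = graphLieGen … S` of `𝔤𝔩_{n+n'}` generated by `Lie(T̃)` and the `ẽ_i, f̃_i`,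
  `i ∈ S`, is contained in `Lie(H_S)` (`graphLieGen_le`) and normalised by `H_S`
  (`conj_mem_graphLieGen`: `Ad ũ_i(x) = exp (x ad ẽ_i)` preserves `𝔡_S`, `expHom_conj_mem`;
  `Ad t̃` fixes `Lie(T̃)` and scales `ẽ_i` by `χ̃_{α_i}(t̃)`), whence
  **`[Lie(H_S), 𝔡_S] ⊆ 𝔡_S`** (`lie_mem_graphLieGen_of_mem_lieAlgebraGL`,
  `lie_mem_of_forall_conj_mem`).

Everything is proved; no named fact is introduced.

## Mathlib

`LieSubalgebra.lieSpan` with `lieSpan_le`, `subset_lieSpan`, `lieSpan_induction`;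
`LieRing.ofAssociativeRing` (commutator bracket on matrices, `Ring.lie_def`); `Matrix.fromBlocks`;
`Subgroup.iSup_induction'`-style induction on generated subgroups (`Subgroup.sup_induction`,
`Subgroup.iSup_induction`). Mathlib has no algebraic groups; nothing here duplicates a Mathlib or
Literature declaration (searched `graphE`, `graphLieGen`, `velocity_rootSL2`, `fromBlocks` +
`weightSpaceGL`).

## References

* [SpringerLAG1998] T. A. Springer, *Linear Algebraic Groups*, 2nd ed., Progress in Mathematics
  9, Birkhäuser (1998): 4.4.5, 4.4.9, 4.4.15, 7.3.5, 8.1.1 (i), Theorem 9.6.2, 10.2.8.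
* J. E. Humphreys, *Linear Algebraic Groups*, GTM 21, Springer (1975), §33.
* J. E. Humphreys, *Introduction to Lie Algebras and Representation Theory*, GTM 9 (1972), §14.2,
  §18.
-/

noncomputable section

open scoped MatrixGroups IsMulCommutative
open Matrix Polynomial TrivSqZeroExt

namespace Literature.NumberTheory.Automorphic

attribute [local instance 100] LieRing.ofAssociativeRing

variable {k : Type*} [Field k] {n n' : Type*} [Fintype n] [DecidableEq n] [Fintype n']
  [DecidableEq n']

/-! ### Calculus on block-diagonal matrices -/

section Calculus

omit [DecidableEq n] [DecidableEq n'] in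
/-- The commutator of block-diagonal matrices is computed blockwise. [folklore] -/
lemma fromBlocks_commutator (A B : Matrix n n k) (A' B' : Matrix n' n' k) :
    fromBlocks A 0 0 A' * fromBlocks B 0 0 B' - fromBlocks B 0 0 B' * fromBlocks A 0 0 A' =
      fromBlocks (A * B - B * A) 0 0 (A' * B' - B' * A') := by
  rw [fromBlocks_zero_mul_fromBlocks_zero, fromBlocks_zero_mul_fromBlocks_zero, sub_eq_add_neg,
    fromBlocks_neg, fromBlocks_add]
  simp [sub_eq_add_neg]

/-- **The differential of `p ∘ fstCoordPoly` at `A` is the differential of `p` at the first block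
of `A`** (from `aeval_dualPoint_fstCoordPoly`). [folklore] -/
theorem tangentDeriv_aeval_fstCoordPoly (p : MvPolynomial (GLCoord n) k) (A : Matrix (n ⊕ n') (n ⊕ n') k) :
    tangentDeriv (MvPolynomial.aeval (fstCoordPoly k n n') p) A = tangentDeriv p A.toBlocks₁₁ := by
  unfold tangentDeriv
  have e := DFunLike.congr_fun
    (MvPolynomial.comp_aeval (f := fstCoordPoly k n n') (MvPolynomial.aeval (dualPoint A))) p
  have e2 : (fun c => MvPolynomial.aeval (dualPoint A) (fstCoordPoly k n n' c)) = dualPoint A.toBlocks₁₁ :=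
    funext (aeval_dualPoint_fstCoordPoly A)
  rw [AlgHom.comp_apply, e2] at e
  rw [e]

/-- The same for the second block. [folklore] -/
theorem tangentDeriv_aeval_sndCoordPoly (p : MvPolynomial (GLCoord n') k) (A : Matrix (n ⊕ n') (n ⊕ n') k) :
    tangentDeriv (MvPolynomial.aeval (sndCoordPoly k n n') p) A = tangentDeriv p A.toBlocks₂₂ := by
  unfold tangentDeriv
  have e := DFunLike.congr_fun
    (MvPolynomial.comp_aeval (f := sndCoordPoly k n n') (MvPolynomial.aeval (dualPoint A))) p
  have e2 : (fun c => MvPolynomial.aeval (dualPoint A) (sndCoordPoly k n n' c)) = dualPoint A.toBlocks₂₂ :=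
    funext (aeval_dualPoint_sndCoordPoly A)
  rw [AlgHom.comp_apply, e2] at e
  rw [e]

/-- The differential at `0` vanishes (linearity). [folklore] -/
lemma tangentDeriv_zero_right (p : MvPolynomial (GLCoord n) k) : tangentDeriv p (0 : Matrix n n k) = 0 :=
  (tangentDerivLin p).map_zero

omit [Fintype n] [DecidableEq n] [Fintype n'] [DecidableEq n'] in
/-- **The Laurent velocity of a block-diagonal pair of Laurent coordinate families** is the block
diagonal of the two velocities. [folklore] -/
lemma laurentVelocity_blockPairPoly (Q : GLCoord n → MvPolynomial (Fin 2) k)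
    (Q' : GLCoord n' → MvPolynomial (Fin 2) k) :
    laurentVelocity (blockPairPoly Q Q') = fromBlocks (laurentVelocity Q) 0 0 (laurentVelocity Q') := by
  ext i j
  rcases i with i | i <;> rcases j with j | j <;> simp [laurentVelocity, blockPairPoly]

/-- Laurent coordinates of a block-diagonal pair of Laurent curves. [folklore] -/
lemma IsLaurentCoordsOf.blockPair {γ : kˣ → GL n k} {γ' : kˣ → GL n' k}
    {Q : GLCoord n → MvPolynomial (Fin 2) k} {Q' : GLCoord n' → MvPolynomial (Fin 2) k}
    (hQ : IsLaurentCoordsOf γ Q) (hQ' : IsLaurentCoordsOf γ' Q') :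
    IsLaurentCoordsOf (fun t => blockDiagGL (γ t, γ' t)) (blockPairPoly Q Q') := by
  intro t c
  rw [glCoordFun_blockDiagGL]
  rcases c with ⟨i | i, j | j⟩ | ⟨⟩ <;> simp [blockPairPoly, hQ t, hQ' t]

/-- **The velocity of a block-diagonal pair of algebraic homomorphisms `𝔾ₐ → G`, `𝔾ₐ → G'`** is
the block diagonal of the two velocities (velocities may be computed on any coordinate
polynomials, `IsAlgebraicAddHom.velocity_eq`). [folklore] -/
theorem IsAlgebraicAddHom.velocity_blockDiagGL_prod [Infinite k] {G : Subgroup (GL n k)} {G' : Subgroup (GL n' k)}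
    {u : Multiplicative k →* ↥G} {u' : Multiplicative k →* ↥G'} (hu : IsAlgebraicAddHom u)
    (hu' : IsAlgebraicAddHom u') {K : Subgroup (GL (n ⊕ n') k)}
    (hK : ∀ x, blockDiagGL ((u x : GL n k), (u' x : GL n' k)) ∈ K) :
    (hu.blockDiagGL_prod hu' hK).velocity = fromBlocks hu.velocity 0 0 hu'.velocity := by
  rw [(hu.blockDiagGL_prod hu' hK).velocity_eq (blockPairPoly hu.choose hu'.choose) (fun x c => by
    rw [MonoidHom.codRestrict_apply]
    change glCoordFun (blockDiagGL (((u (Multiplicative.ofAdd x) : ↥G) : GL n k),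
      ((u' (Multiplicative.ofAdd x) : ↥G') : GL n' k))) c = _
    rw [glCoordFun_blockDiagGL]
    rcases c with ⟨i | i, j | j⟩ | ⟨⟩ <;> simp [blockPairPoly, hu.choose_spec x, hu'.choose_spec x])]
  ext i j
  rcases i with i | i <;> rcases j with j | j <;>
    simp [blockPairPoly, IsAlgebraicAddHom.velocity]

/-- `expHom` only depends on the matrix (transport of the nilpotency proof). [folklore] -/
lemma expHom_congr [CharZero k] {m : Type*} [Fintype m] [DecidableEq m] {A B : Matrix m m k}
    (hA : IsNilpotent A) (hB : IsNilpotent B) (e : A = B) (x : Multiplicative k) :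
    expHom A hA x = expHom B hB x := by
  subst e; rfl

end Calculus

/-! ### The velocity of `φ ∘ u⁺` is `dφ E` -/

section VelocitySL2

variable [Infinite k] {G : Subgroup (GL n k)} {φ : SL(2, k) →* ↥G} (hφ : IsAlgebraicSL2Hom φ)

/-- **`velocity (φ ∘ u⁺) = dφ (E)`** for an algebraic `φ : SL₂ → G`: compute the velocity on the
coordinate polynomials `compFam hφ qUpper` of `s ↦ φ (u⁺(s))` (`eval_compFam`, `curveSL2_qUpper`)
and apply the chain rule `coeff_one_compFam` (Springer 4.4.9). [cite: SpringerLAG1998, 4.4.9] -/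
theorem IsAlgebraicSL2Hom.velocity_comp_upper (hu : IsAlgebraicAddHom (φ.comp unipotentUpperSL2)) :
    hu.velocity = sl2Diff hφ slE := by
  rw [hu.velocity_eq (compFam hφ qUpper) (fun x c => by
    rw [eval_compFam hφ qUpper det_qUpper, curveSL2_qUpper]; rfl)]
  ext i j
  rw [Matrix.of_apply, coeff_one_compFam hφ qUpper qUpper_coeff_zero, qUpper_coeff_one]

/-- **`velocity (φ ∘ u⁻) = dφ (F)`.** [cite: SpringerLAG1998, 4.4.9] -/
theorem IsAlgebraicSL2Hom.velocity_comp_lower (hv : IsAlgebraicAddHom (φ.comp unipotentLowerSL2)) :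
    hv.velocity = sl2Diff hφ slF := by
  rw [hv.velocity_eq (compFam hφ qLower) (fun x c => by
    rw [eval_compFam hφ qLower det_qLower, curveSL2_qLower]; rfl)]
  ext i j
  rw [Matrix.of_apply, coeff_one_compFam hφ qLower qLower_coeff_zero, qLower_coeff_one]

variable {ι X Y : Type*} [AddCommGroup X] [AddCommGroup Y] {T : Subgroup (GL n k)}
  [IsMulCommutative ↥T] {P : RootPairing ι ℤ X Y} {eX : Additive ↥(characterLattice T) ≃+ X}
  {eY : Additive ↥(cocharacterLattice T) ≃+ Y}

/-- `velocity (u_i) = e_i` for the root homomorphism `u_i = φ_i ∘ u⁺` of the chosen `SL₂` of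
`α_i`. [cite: SpringerLAG1998, 4.4.9] -/
theorem IsRootDatumOf.velocity_rootSL2_upper (h : IsRootDatumOf G T P eX eY) (i : ι) :
    (h.isRootHom_rootSL2_upper i).1.velocity = h.rootE i :=
  (h.isAlgebraicSL2Hom_rootSL2 i).velocity_comp_upper _

/-- `velocity (v_i) = f_i` for `v_i = φ_i ∘ u⁻`. [cite: SpringerLAG1998, 4.4.9] -/
theorem IsRootDatumOf.velocity_rootSL2_lower (h : IsRootDatumOf G T P eX eY) (i : ι) :
    (h.isRootHom_rootSL2_lower i).1.velocity = h.rootF i :=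
  (h.isAlgebraicSL2Hom_rootSL2 i).velocity_comp_lower _

end VelocitySL2

variable {ι X Y : Type*} [AddCommGroup X] [AddCommGroup Y]
variable {G T : Subgroup (GL n k)} {G' T' : Subgroup (GL n' k)}
variable [IsMulCommutative ↥T] [IsMulCommutative ↥T']
variable {P : RootPairing ι ℤ X Y}
variable {eX : Additive ↥(characterLattice T) ≃+ X} {eY : Additive ↥(cocharacterLattice T) ≃+ Y}
variable {eX' : Additive ↥(characterLattice T') ≃+ X} {eY' : Additive ↥(cocharacterLattice T') ≃+ Y}

/-! ### The diagonal root vectors `ẽ_i, f̃_i, h̃_i` -/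

section Generators

variable (h : IsRootDatumOf G T P eX eY) (h' : IsRootDatumOf G' T' P eX' eY')

/-- **The diagonal root vector `ẽ_i = diag(e_i, e'_i)`.** [folklore] -/
def graphE (i : ι) : Matrix (n ⊕ n') (n ⊕ n') k := fromBlocks (h.rootE i) 0 0 (h'.rootE i)

/-- **The diagonal root vector `f̃_i = diag(f_i, f'_i)`.** [folklore] -/
def graphF (i : ι) : Matrix (n ⊕ n') (n ⊕ n') k := fromBlocks (h.rootF i) 0 0 (h'.rootF i)

/-- **The diagonal coroot vector `h̃_i = diag(h_i, h'_i)`.** [folklore] -/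
def graphHc (i : ι) : Matrix (n ⊕ n') (n ⊕ n') k := fromBlocks (h.rootH i) 0 0 (h'.rootH i)

variable [Infinite k]

/-- `[ẽ_i, f̃_i] = h̃_i` (blockwise `[e_i, f_i] = h_i`). [cite: SpringerLAG1998, 4.4.9] -/
theorem lie_graphE_graphF (i : ι) :
    graphE h h' i * graphF h h' i - graphF h h' i * graphE h h' i = graphHc h h' i := by
  rw [graphE, graphF, graphHc, fromBlocks_commutator, h.lie_rootE_rootF, h'.lie_rootE_rootF]

/-- `[h̃_i, ẽ_j] = ⟨α_j, α_i^∨⟩ ẽ_j` (the Cartan integers, on both blocks). [cite: Humphreys1972, 8.4] -/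
theorem lie_graphHc_graphE (i j : ι) :
    graphHc h h' i * graphE h h' j - graphE h h' j * graphHc h h' i = ((P.pairing j i : ℤ) : k) • graphE h h' j := by
  rw [graphE, graphHc, fromBlocks_commutator, h.lie_rootH_rootE_eq, h'.lie_rootH_rootE_eq,
    fromBlocks_smul, smul_zero, smul_zero]

/-- `[h̃_i, f̃_j] = -⟨α_j, α_i^∨⟩ f̃_j`. [cite: Humphreys1972, 8.4] -/
theorem lie_graphHc_graphF (i j : ι) :
    graphHc h h' i * graphF h h' j - graphF h h' j * graphHc h h' i = -(((P.pairing j i : ℤ) : k) • graphF h h' j) := by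
  rw [graphF, graphHc, fromBlocks_commutator, h.lie_rootH_rootF_eq, h'.lie_rootH_rootF_eq,
    fromBlocks_smul, smul_zero, smul_zero, fromBlocks_neg, neg_zero, neg_zero]

/-- `ẽ_i ≠ 0`. [folklore] -/
theorem graphE_ne_zero (i : ι) : graphE h h' i ≠ 0 := by
  intro h0
  rw [graphE, ← fromBlocks_zero, fromBlocks_inj] at h0
  exact h.rootE_ne_zero i h0.1

/-- `f̃_i ≠ 0`. [folklore] -/
theorem graphF_ne_zero (i : ι) : graphF h h' i ≠ 0 := by
  intro h0
  rw [graphF, ← fromBlocks_zero, fromBlocks_inj] at h0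
  exact h.rootF_ne_zero i h0.1

omit [Infinite k] in
/-- The blocks of `ẽ_i`. [folklore] -/
@[simp] lemma toBlocks₁₁_graphE (i : ι) : (graphE h h' i).toBlocks₁₁ = h.rootE i :=
  toBlocks_fromBlocks₁₁ _ _ _ _
omit [Infinite k] in
/-- The blocks of `ẽ_i`. [folklore] -/
@[simp] lemma toBlocks₂₂_graphE (i : ι) : (graphE h h' i).toBlocks₂₂ = h'.rootE i :=
  toBlocks_fromBlocks₂₂ _ _ _ _
omit [Infinite k] in
/-- The blocks of `f̃_i`. [folklore] -/
@[simp] lemma toBlocks₁₁_graphF (i : ι) : (graphF h h' i).toBlocks₁₁ = h.rootF i :=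
  toBlocks_fromBlocks₁₁ _ _ _ _
omit [Infinite k] in
/-- The blocks of `f̃_i`. [folklore] -/
@[simp] lemma toBlocks₂₂_graphF (i : ι) : (graphF h h' i).toBlocks₂₂ = h'.rootF i :=
  toBlocks_fromBlocks₂₂ _ _ _ _
omit [Infinite k] in
/-- The blocks of `h̃_i`. [folklore] -/
@[simp] lemma toBlocks₁₁_graphHc (i : ι) : (graphHc h h' i).toBlocks₁₁ = h.rootH i :=
  toBlocks_fromBlocks₁₁ _ _ _ _
omit [Infinite k] in
/-- The blocks of `h̃_i`. [folklore] -/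
@[simp] lemma toBlocks₂₂_graphHc (i : ι) : (graphHc h h' i).toBlocks₂₂ = h'.rootH i :=
  toBlocks_fromBlocks₂₂ _ _ _ _

variable [IsAlgClosed k] (hT : IsTorusSubgroup T) (hT' : IsTorusSubgroup T')
include hT hT'

/-- **`ẽ_i` is the velocity of `ũ_i`** (blockwise `velocity u_i = e_i`). [cite: SpringerLAG1998, 4.4.9] -/
theorem velocity_graphUpper (i : ι) :
    (isRootHom_graphUpper h h' hT hT' i).1.velocity = graphE h h' i := by
  have e := (h.isRootHom_rootSL2_upper i).1.velocity_blockDiagGL_prod (h'.isRootHom_rootSL2_upper i).1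
    (graphUpperGL_mem_prodBlock h h' i)
  rw [h.velocity_rootSL2_upper, h'.velocity_rootSL2_upper] at e
  exact e

/-- **`f̃_i` is the velocity of `ṽ_i`.** [cite: SpringerLAG1998, 4.4.9] -/
theorem velocity_graphLower (i : ι) :
    (isRootHom_graphLower h h' hT hT' i).1.velocity = graphF h h' i := by
  have e := (h.isRootHom_rootSL2_lower i).1.velocity_blockDiagGL_prod (h'.isRootHom_rootSL2_lower i).1
    (graphLowerGL_mem_prodBlock h h' i)
  rw [h.velocity_rootSL2_lower, h'.velocity_rootSL2_lower] at e
  exact e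

/-- `ẽ_i ∈ Lie(Ũ_i)`. [cite: SpringerLAG1998, 4.4.9] -/
theorem graphE_mem_lieAlgebraGL_range (i : ι) : graphE h h' i ∈ lieAlgebraGL (graphUpperGL h h' i).range := by
  rw [← velocity_graphUpper h h' hT hT' i, ← map_range_graphUpper]
  exact (isRootHom_graphUpper h h' hT hT' i).1.velocity_mem_lieAlgebraGL le_rfl

/-- `f̃_i ∈ Lie(Ṽ_i)`. [cite: SpringerLAG1998, 4.4.9] -/
theorem graphF_mem_lieAlgebraGL_range (i : ι) : graphF h h' i ∈ lieAlgebraGL (graphLowerGL h h' i).range := by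
  rw [← velocity_graphLower h h' hT hT' i, ← map_range_graphLower]
  exact (isRootHom_graphLower h h' hT hT' i).1.velocity_mem_lieAlgebraGL le_rfl

/-- **`ẽ_i ∈ Lie(H_S)` for `i ∈ S`.** [folklore] -/
theorem graphE_mem_lieAlgebraGL_graphGroup {S : Set ι} {i : ι} (hi : i ∈ S) :
    graphE h h' i ∈ lieAlgebraGL (graphGroup h h' hT hT' S) :=
  lieAlgebraGL_mono (range_graphUpperGL_le_graphGroup h h' hT hT' S hi) (graphE_mem_lieAlgebraGL_range h h' hT hT' i)

/-- **`f̃_i ∈ Lie(H_S)` for `i ∈ S`.** [folklore] -/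
theorem graphF_mem_lieAlgebraGL_graphGroup {S : Set ι} {i : ι} (hi : i ∈ S) :
    graphF h h' i ∈ lieAlgebraGL (graphGroup h h' hT hT' S) :=
  lieAlgebraGL_mono (range_graphLowerGL_le_graphGroup h h' hT hT' S hi) (graphF_mem_lieAlgebraGL_range h h' hT hT' i)

/-- `ẽ_i` is a weight vector of `T̃` of weight `χ̃_{α_i}`. [cite: SpringerLAG1998, 8.1.1 (i)] -/
theorem graphE_mem_weightSpaceGL (i : ι) :
    graphE h h' i ∈ weightSpaceGL (graphTorus eX eX' hT hT') (graphChar eX eX' hT hT' (P.root i)) := by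
  rw [← velocity_graphUpper h h' hT hT' i]
  exact (isRootHom_graphUpper h h' hT hT' i).velocity_mem_weightSpaceGL

/-- `f̃_i` is a weight vector of `T̃` of weight `χ̃_{-α_i}`. [cite: SpringerLAG1998, 8.1.1 (i)] -/
theorem graphF_mem_weightSpaceGL (i : ι) :
    graphF h h' i ∈ weightSpaceGL (graphTorus eX eX' hT hT') (graphChar eX eX' hT hT' (-P.root i)) := by
  rw [← velocity_graphLower h h' hT hT' i]
  exact (isRootHom_graphLower' h h' hT hT' i).velocity_mem_weightSpaceGL

omit [Infinite k] in
/-- `χ̃_{α_i} ≠ 1` (roots are non-zero). [folklore] -/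
theorem graphChar_root_ne_one (i : ι) : graphChar eX eX' hT hT' (P.root i) ≠ 1 := by
  rw [Ne, ← graphChar_zero eX eX' hT hT', (graphChar_injective eX eX' hT hT').eq_iff]
  exact P.ne_zero i

omit [Infinite k] in
/-- `χ̃_{-α_i} ≠ 1`. [folklore] -/
theorem graphChar_neg_root_ne_one (i : ι) : graphChar eX eX' hT hT' (-P.root i) ≠ 1 := by
  rw [Ne, ← graphChar_zero eX eX' hT hT', (graphChar_injective eX eX' hT hT').eq_iff, neg_eq_zero]
  exact P.ne_zero i

/-- `ẽ_i` is nilpotent (a weight vector of a non-trivial character of the connected `T̃`).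
[folklore] -/
theorem isNilpotent_graphE (i : ι) : IsNilpotent (graphE h h' i) :=
  isNilpotent_of_mem_weightSpaceGL (isZConnected_graphTorus eX eX' hT hT')
    (isAlgebraicChar_graphChar eX eX' hT hT' _) (graphChar_root_ne_one hT hT' i)
    (graphE_mem_weightSpaceGL h h' hT hT' i)

/-- `f̃_i` is nilpotent. [folklore] -/
theorem isNilpotent_graphF (i : ι) : IsNilpotent (graphF h h' i) :=
  isNilpotent_of_mem_weightSpaceGL (isZConnected_graphTorus eX eX' hT hT')
    (isAlgebraicChar_graphChar eX eX' hT hT' _) (graphChar_neg_root_ne_one hT hT' i)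
    (graphF_mem_weightSpaceGL h h' hT hT' i)

variable [CharZero k]

/-- **`ũ_i(x) = exp (x ẽ_i)`** (a unipotent one-parameter group is the exponential of its velocity
in characteristic `0`, `IsRootHom.coe_apply_eq_exp`, applied to the root homomorphism `ũ_i` of
`(G × G', T̃)`). [cite: SpringerLAG1998, 4.4.9 and 8.1.1 (i)] -/
theorem graphUpperGL_eq_expHom (hG : IsAlgebraicSubgroup G) (hG' : IsAlgebraicSubgroup G') (i : ι) (x : k) :
    graphUpperGL h h' i (Multiplicative.ofAdd x) =
      expHom (graphE h h' i) (isNilpotent_graphE h h' hT hT' i) (Multiplicative.ofAdd x) := by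
  have hnil : IsNilpotent (isRootHom_graphUpper h h' hT hT' i).1.velocity := by
    rw [velocity_graphUpper h h' hT hT' i]; exact isNilpotent_graphE h h' hT hT' i
  have e := (isRootHom_graphUpper h h' hT hT' i).coe_apply_eq_exp (isAlgebraicSubgroup_prodBlock hG hG') hnil x
  rw [coe_graphUpper_apply] at e
  rw [e]
  exact expHom_congr _ _ (velocity_graphUpper h h' hT hT' i) _

/-- **`ṽ_i(x) = exp (x f̃_i)`.** [cite: SpringerLAG1998, 4.4.9 and 8.1.1 (i)] -/
theorem graphLowerGL_eq_expHom (hG : IsAlgebraicSubgroup G) (hG' : IsAlgebraicSubgroup G') (i : ι) (x : k) :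
    graphLowerGL h h' i (Multiplicative.ofAdd x) =
      expHom (graphF h h' i) (isNilpotent_graphF h h' hT hT' i) (Multiplicative.ofAdd x) := by
  have hnil : IsNilpotent (isRootHom_graphLower h h' hT hT' i).1.velocity := by
    rw [velocity_graphLower h h' hT hT' i]; exact isNilpotent_graphF h h' hT hT' i
  have e := (isRootHom_graphLower h h' hT hT' i).coe_apply_eq_exp (isAlgebraicSubgroup_prodBlock hG hG') hnil x
  rw [coe_graphLower_apply] at e
  rw [e]
  exact expHom_congr _ _ (velocity_graphLower h h' hT hT' i) _

omit [CharZero k] in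
/-- **`h̃_i ∈ Lie(T̃)`**: `h̃_i` is the Laurent velocity of the cocharacter `t ↦ diag(φ_i(diag t),
φ'_i(diag t)) = diag(α_i^∨ t, f_T(α_i^∨ t))` of `T̃` (blockwise `dφ H` is that velocity,
`sl2Diff_slH_eq_laurentVelocity`). [cite: SpringerLAG1998, 4.4.9 and 7.3.5] -/
theorem graphHc_mem_lieAlgebraGL_graphTorus (i : ι) :
    graphHc h h' i ∈ lieAlgebraGL (graphTorus eX eX' hT hT') := by
  have hQ := (isLaurentCoordsOf_sl2DiagCoords (h.isAlgebraicSL2Hom_rootSL2 i)).blockPair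
    (isLaurentCoordsOf_sl2DiagCoords (h'.isAlgebraicSL2Hom_rootSL2 i))
  have hmem := hQ.laurentVelocity_mem_lieAlgebraGL (H := graphTorus eX eX' hT hT') (by
      change blockDiagGL (((h.rootSL2 i (diagSL2 1) : ↥G) : GL n k), ((h'.rootSL2 i (diagSL2 1) : ↥G') : GL n' k)) = 1
      have e1 : (diagSL2 (1 : kˣ) : SL(2, k)) = 1 := Subtype.ext (by simp [Matrix.one_fin_two])
      rw [e1, map_one, map_one]; exact map_one _)
    (fun t => by
      change blockDiagGL (((h.rootSL2 i (diagSL2 t) : ↥G) : GL n k), ((h'.rootSL2 i (diagSL2 t) : ↥G') : GL n' k)) ∈ _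
      rw [← graphSL2_apply]; exact graphSL2_diagSL2_mem_graphTorus h h' hT hT' i t)
  rw [laurentVelocity_blockPairPoly, ← sl2Diff_slH_eq_laurentVelocity, ← sl2Diff_slH_eq_laurentVelocity] at hmem
  exact hmem

omit [CharZero k] in
/-- `h̃_i ∈ Lie(H_S)`. [folklore] -/
theorem graphHc_mem_lieAlgebraGL_graphGroup (S : Set ι) (i : ι) :
    graphHc h h' i ∈ lieAlgebraGL (graphGroup h h' hT hT' S) :=
  lieAlgebraGL_mono (graphTorus_le_graphGroup h h' hT hT' S) (graphHc_mem_lieAlgebraGL_graphTorus h h' hT hT' i)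

end Generators

/-! ### The Lie algebra of the graph torus is a graph -/

section TorusLie

variable [IsAlgClosed k] (eX eX') (hT : IsTorusSubgroup T) (hT' : IsTorusSubgroup T')

/-- Elements of `Lie(T̃)` are block diagonal with blocks in `Lie(T)`, `Lie(T')`. [folklore] -/
theorem eq_fromBlocks_of_mem_lieAlgebraGL_graphTorus {A : Matrix (n ⊕ n') (n ⊕ n') k}
    (hA : A ∈ lieAlgebraGL (graphTorus eX eX' hT hT')) :
    A = fromBlocks A.toBlocks₁₁ 0 0 A.toBlocks₂₂ ∧ A.toBlocks₁₁ ∈ lieAlgebraGL T ∧ A.toBlocks₂₂ ∈ lieAlgebraGL T' :=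
  eq_fromBlocks_of_mem_lieAlgebraGL_of_le (graphTorus_le_prodBlock eX eX' hT hT') hA

/-- **An element of `Lie(T̃)` with vanishing first block vanishes**: the equations
`x_{inr i, inr j} = Q_{ij} (first block)` of `T̃` (`Q` the polynomials of `f_T`) differentiate to
`A_{inr i, inr j} = dQ_{ij} (A₁₁)`. [folklore] -/
theorem eq_zero_of_mem_lieAlgebraGL_graphTorus_of_toBlocks₁₁ {A : Matrix (n ⊕ n') (n ⊕ n') k}
    (hA : A ∈ lieAlgebraGL (graphTorus eX eX' hT hT')) (h0 : A.toBlocks₁₁ = 0) : A = 0 := by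
  obtain ⟨Q, hQ⟩ := isAlgebraicGL_torusIsoOfWeights eX eX' hT hT'
  obtain ⟨eA, -, -⟩ := eq_fromBlocks_of_mem_lieAlgebraGL_graphTorus eX eX' hT hT' hA
  have h22 : A.toBlocks₂₂ = 0 := by
    ext i j
    -- the polynomial `x_{inr i, inr j} - Q_{ij} ∘ fst` vanishes on `T̃`
    have hmem : MvPolynomial.X (Sum.inl (Sum.inr i, Sum.inr j)) -
        MvPolynomial.aeval (fstCoordPoly k n n') (Q (Sum.inl (i, j))) ∈
        MvPolynomial.vanishingIdeal k (glCoordFun '' (graphTorus eX eX' hT hT' : Set (GL (n ⊕ n') k))) := by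
      rw [MvPolynomial.mem_vanishingIdeal_iff]
      rintro _ ⟨_, ⟨t, rfl⟩, rfl⟩
      change MvPolynomial.eval (glCoordFun (graphTorusHom eX eX' hT hT' t)) _ = 0
      rw [map_sub, graphTorusHom_apply, eval_aeval_fstCoordPoly, ← hQ t, MvPolynomial.eval_X, sub_eq_zero]
      simp
    have hd := (mem_lieAlgebraGL_iff.1 hA) _ hmem
    rw [tangentDeriv_sub, tangentDeriv_X, tangentDeriv_aeval_fstCoordPoly, h0, tangentDeriv_zero_right,
      sub_zero] at hd
    simpa [tangentCoord, Matrix.toBlocks₂₂] using hd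
  rw [eA, h0, h22, fromBlocks_zero]

/-- **An element of `Lie(T̃)` with vanishing second block vanishes** (use the polynomials of
`f_T⁻¹`). [folklore] -/
theorem eq_zero_of_mem_lieAlgebraGL_graphTorus_of_toBlocks₂₂ {A : Matrix (n ⊕ n') (n ⊕ n') k}
    (hA : A ∈ lieAlgebraGL (graphTorus eX eX' hT hT')) (h0 : A.toBlocks₂₂ = 0) : A = 0 := by
  obtain ⟨Q, hQ⟩ := isAlgebraicGL_torusIsoOfWeights_symm eX eX' hT hT'
  obtain ⟨eA, -, -⟩ := eq_fromBlocks_of_mem_lieAlgebraGL_graphTorus eX eX' hT hT' hA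
  have h11 : A.toBlocks₁₁ = 0 := by
    ext i j
    have hmem : MvPolynomial.X (Sum.inl (Sum.inl i, Sum.inl j)) -
        MvPolynomial.aeval (sndCoordPoly k n n') (Q (Sum.inl (i, j))) ∈
        MvPolynomial.vanishingIdeal k (glCoordFun '' (graphTorus eX eX' hT hT' : Set (GL (n ⊕ n') k))) := by
      rw [MvPolynomial.mem_vanishingIdeal_iff]
      rintro _ ⟨_, ⟨t, rfl⟩, rfl⟩
      change MvPolynomial.eval (glCoordFun (graphTorusHom eX eX' hT hT' t)) _ = 0
      rw [map_sub, graphTorusHom_apply, eval_aeval_sndCoordPoly, MvPolynomial.eval_X, sub_eq_zero]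
      have e := hQ (torusIsoOfWeights eX eX' hT hT' t) (Sum.inl (i, j))
      rw [MonoidHom.comp_apply, MulEquiv.coe_toMonoidHom, MulEquiv.symm_apply_apply] at e
      rw [← e]
      simp
    have hd := (mem_lieAlgebraGL_iff.1 hA) _ hmem
    rw [tangentDeriv_sub, tangentDeriv_X, tangentDeriv_aeval_sndCoordPoly, h0, tangentDeriv_zero_right,
      sub_zero] at hd
    simpa [tangentCoord, Matrix.toBlocks₁₁] using hd
  rw [eA, h0, h11, fromBlocks_zero]

/-- **`Lie(T̃)` is the graph of a map on first blocks**: two elements of `Lie(T̃)` with the same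
first block are equal. [folklore] -/
theorem eq_of_mem_lieAlgebraGL_graphTorus_of_toBlocks₁₁_eq {A B : Matrix (n ⊕ n') (n ⊕ n') k}
    (hA : A ∈ lieAlgebraGL (graphTorus eX eX' hT hT')) (hB : B ∈ lieAlgebraGL (graphTorus eX eX' hT hT'))
    (hAB : A.toBlocks₁₁ = B.toBlocks₁₁) : A = B := by
  have h := eq_zero_of_mem_lieAlgebraGL_graphTorus_of_toBlocks₁₁ eX eX' hT hT' (Submodule.sub_mem _ hA hB)
    (by ext i j
        have e := congrFun (congrFun hAB i) j
        simp only [Matrix.toBlocks₁₁, Matrix.of_apply] at e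
        simp [Matrix.toBlocks₁₁, e])
  exact sub_eq_zero.1 h

/-- Two elements of `Lie(T̃)` with the same second block are equal. [folklore] -/
theorem eq_of_mem_lieAlgebraGL_graphTorus_of_toBlocks₂₂_eq {A B : Matrix (n ⊕ n') (n ⊕ n') k}
    (hA : A ∈ lieAlgebraGL (graphTorus eX eX' hT hT')) (hB : B ∈ lieAlgebraGL (graphTorus eX eX' hT hT'))
    (hAB : A.toBlocks₂₂ = B.toBlocks₂₂) : A = B := by
  have h := eq_zero_of_mem_lieAlgebraGL_graphTorus_of_toBlocks₂₂ eX eX' hT hT' (Submodule.sub_mem _ hA hB)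
    (by ext i j
        have e := congrFun (congrFun hAB i) j
        simp only [Matrix.toBlocks₂₂, Matrix.of_apply] at e
        simp [Matrix.toBlocks₂₂, e])
  exact sub_eq_zero.1 h

end TorusLie

/-! ### Weight vectors of the graph torus -/

section Weights

variable [IsAlgClosed k] (eX eX') (hT : IsTorusSubgroup T) (hT' : IsTorusSubgroup T')

/-- **Weight vectors of `T̃` among block-diagonal matrices**: `diag(B, B')` has weight `χ̃_x` iff
`B` has weight `χ_x` for `T` and `B'` has weight `χ'_x` for `T'` (conjugation by `diag(t, f_T t)` is
blockwise, and `χ̃_x (diag(t, f_T t)) = χ_x(t) = χ'_x(f_T t)`). [folklore] -/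
theorem fromBlocks_mem_weightSpaceGL_graphTorus_iff (x : X) (B : Matrix n n k) (B' : Matrix n' n' k) :
    fromBlocks B 0 0 B' ∈ weightSpaceGL (graphTorus eX eX' hT hT') (graphChar eX eX' hT hT' x) ↔
      B ∈ weightSpaceGL T (charOfWeight eX x) ∧ B' ∈ weightSpaceGL T' (charOfWeight eX' x) := by
  have key : ∀ t : ↥T,
      ((graphTorusHom eX eX' hT hT' t : GL (n ⊕ n') k) : Matrix (n ⊕ n') (n ⊕ n') k) * fromBlocks B 0 0 B' *
          ((graphTorusHom eX eX' hT hT' t : GL (n ⊕ n') k) : Matrix (n ⊕ n') (n ⊕ n') k)⁻¹ =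
        fromBlocks (((t : GL n k) : Matrix n n k) * B * ((t : GL n k) : Matrix n n k)⁻¹) 0 0
          ((((torusIsoOfWeights eX eX' hT hT' t : ↥T') : GL n' k) : Matrix n' n' k) * B' *
            (((torusIsoOfWeights eX eX' hT hT' t : ↥T') : GL n' k) : Matrix n' n' k)⁻¹) := by
    intro t
    rw [← Matrix.coe_units_inv, graphTorusHom_apply, blockDiagGL_conj_fromBlocks, Matrix.coe_units_inv,
      Matrix.coe_units_inv]
  simp only [mem_weightSpaceGL_iff]
  constructor
  · intro hM
    constructor
    · intro t
      have e := hM (graphTorusEquiv eX eX' hT hT' t)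
      rw [coe_graphTorusEquiv, key, graphChar_graphTorusEquiv, fromBlocks_smul, fromBlocks_inj] at e
      exact e.1
    · intro t'
      have e := hM (graphTorusEquiv eX eX' hT hT' ((torusIsoOfWeights eX eX' hT hT').symm t'))
      rw [coe_graphTorusEquiv, key, graphChar_graphTorusEquiv', MulEquiv.apply_symm_apply, fromBlocks_smul,
        fromBlocks_inj] at e
      exact e.2.2.2
  · rintro ⟨hB, hB'⟩ s
    obtain ⟨t, rfl⟩ := graphTorus.exists_eq eX eX' hT hT' s
    rw [coe_graphTorusEquiv, key, graphChar_graphTorusEquiv, fromBlocks_smul, hB t,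
      ← charOfWeight_torusIsoOfWeights eX eX' hT hT' x t, hB' _, smul_zero, smul_zero]

variable (h : IsRootDatumOf G T P eX eY) (h' : IsRootDatumOf G' T' P eX' eY') {S : Set ι}

/-- **Weight vectors of `Lie(H_S)`**: an element of `Lie(H_S)` of weight `χ̃_x` is `diag(B, B')`
with `B ∈ 𝔤_x = Lie(G) ∩ (𝔤𝔩_n)_{χ_x}` and `B' ∈ 𝔤'_x`. [folklore] -/
theorem mem_lieAlgebraGL_graphGroup_weight {x : X} {A : Matrix (n ⊕ n') (n ⊕ n') k}
    (hA : A ∈ lieAlgebraGL (graphGroup h h' hT hT' S))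
    (hw : A ∈ weightSpaceGL (graphTorus eX eX' hT hT') (graphChar eX eX' hT hT' x)) :
    A = fromBlocks A.toBlocks₁₁ 0 0 A.toBlocks₂₂ ∧ A.toBlocks₁₁ ∈ lieWeightSpace G T (charOfWeight eX x) ∧
      A.toBlocks₂₂ ∈ lieWeightSpace G' T' (charOfWeight eX' x) := by
  obtain ⟨eA, h₁, h₂⟩ := eq_fromBlocks_of_mem_lieAlgebraGL_of_le (graphGroup_le_prodBlock h h' hT hT' S) hA
  rw [eA] at hw
  obtain ⟨w₁, w₂⟩ := (fromBlocks_mem_weightSpaceGL_graphTorus_iff eX eX' hT hT' x _ _).1 hw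
  exact ⟨eA, ⟨h₁, w₁⟩, ⟨h₂, w₂⟩⟩

variable [CharZero k] (hG : IsConnectedReductive G) (hTm : IsMaximalTorusIn T G)
  (hG' : IsConnectedReductive G') (hTm' : IsMaximalTorusIn T' G')

include hG hTm hG' hTm' in
/-- **Weight vectors of `Lie(H_S)` of root weight**: an element of `Lie(H_S)` of weight `χ̃_{α_i}`
is `diag(a e_i, a' e'_i)` (root spaces are lines spanned by the chosen root vectors,
`IsRootDatumOf.mem_lieWeightSpace_root_iff`, Springer 8.1.2 in characteristic `0`).
[cite: SpringerLAG1998, Cor. 8.1.2] -/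
theorem mem_lieAlgebraGL_graphGroup_weight_root {i : ι} {A : Matrix (n ⊕ n') (n ⊕ n') k}
    (hA : A ∈ lieAlgebraGL (graphGroup h h' hTm.2.1 hTm'.2.1 S))
    (hw : A ∈ weightSpaceGL (graphTorus eX eX' hTm.2.1 hTm'.2.1) (graphChar eX eX' hTm.2.1 hTm'.2.1 (P.root i))) :
    ∃ a a' : k, A = fromBlocks (a • h.rootE i) 0 0 (a' • h'.rootE i) := by
  obtain ⟨eA, h₁, h₂⟩ := mem_lieAlgebraGL_graphGroup_weight eX eX' hTm.2.1 hTm'.2.1 h h' hA hw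
  obtain ⟨a, ha⟩ := (h.mem_lieWeightSpace_root_iff hG hTm i).1 h₁
  obtain ⟨a', ha'⟩ := (h'.mem_lieWeightSpace_root_iff hG' hTm' i).1 h₂
  exact ⟨a, a', by rw [eA, ha, ha']⟩

include hG hTm hG' hTm' in
/-- Weight vectors of `Lie(H_S)` of weight `χ̃_{-α_i}` are `diag(a f_i, a' f'_i)`.
[cite: SpringerLAG1998, Cor. 8.1.2] -/
theorem mem_lieAlgebraGL_graphGroup_weight_neg_root {i : ι} {A : Matrix (n ⊕ n') (n ⊕ n') k}
    (hA : A ∈ lieAlgebraGL (graphGroup h h' hTm.2.1 hTm'.2.1 S))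
    (hw : A ∈ weightSpaceGL (graphTorus eX eX' hTm.2.1 hTm'.2.1) (graphChar eX eX' hTm.2.1 hTm'.2.1 (-P.root i))) :
    ∃ a a' : k, A = fromBlocks (a • h.rootF i) 0 0 (a' • h'.rootF i) := by
  obtain ⟨eA, h₁, h₂⟩ := mem_lieAlgebraGL_graphGroup_weight eX eX' hTm.2.1 hTm'.2.1 h h' hA hw
  obtain ⟨a, ha⟩ := (h.mem_lieWeightSpace_neg_root_iff hG hTm i).1 h₁
  obtain ⟨a', ha'⟩ := (h'.mem_lieWeightSpace_neg_root_iff hG' hTm' i).1 h₂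
  exact ⟨a, a', by rw [eA, ha, ha']⟩

include hG hTm hG' hTm' in
/-- **Weight vectors of `Lie(H_S)` of weight `0`** are `diag(z, z')` with `z ∈ Lie(T)`,
`z' ∈ Lie(T')` (`𝔤^T = Lie(T)`, Springer 5.4.7 with 7.6.4 (ii), `lieWeightSpace_one_eq`).
[cite: SpringerLAG1998, Cor. 5.4.7 and 7.6.4 (ii)] -/
theorem mem_lieAlgebraGL_graphGroup_weight_zero {A : Matrix (n ⊕ n') (n ⊕ n') k}
    (hA : A ∈ lieAlgebraGL (graphGroup h h' hTm.2.1 hTm'.2.1 S))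
    (hw : A ∈ weightSpaceGL (graphTorus eX eX' hTm.2.1 hTm'.2.1) (graphChar eX eX' hTm.2.1 hTm'.2.1 0)) :
    A = fromBlocks A.toBlocks₁₁ 0 0 A.toBlocks₂₂ ∧ A.toBlocks₁₁ ∈ lieAlgebraGL T ∧ A.toBlocks₂₂ ∈ lieAlgebraGL T' := by
  obtain ⟨eA, h₁, h₂⟩ := mem_lieAlgebraGL_graphGroup_weight eX eX' hTm.2.1 hTm'.2.1 h h' hA hw
  rw [lieWeightSpace_charOfWeight_zero_eq, lieWeightSpace_one_eq hG hTm] at h₁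
  rw [lieWeightSpace_charOfWeight_zero_eq, lieWeightSpace_one_eq hG' hTm'] at h₂
  exact ⟨eA, h₁, h₂⟩

include hG hTm hG' hTm' in
/-- **Weight vectors of `Lie(H_S)` of a non-zero weight which is not a root vanish** (`𝔤_x = 0`
for such `x`, Springer 8.1.2 / `lieWeights_eq_roots` in characteristic `0`).
[cite: SpringerLAG1998, Cor. 8.1.2] -/
theorem mem_lieAlgebraGL_graphGroup_weight_eq_zero {x : X} (hx0 : x ≠ 0) (hx : x ∉ Set.range P.root)
    {A : Matrix (n ⊕ n') (n ⊕ n') k} (hA : A ∈ lieAlgebraGL (graphGroup h h' hTm.2.1 hTm'.2.1 S))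
    (hw : A ∈ weightSpaceGL (graphTorus eX eX' hTm.2.1 hTm'.2.1) (graphChar eX eX' hTm.2.1 hTm'.2.1 x)) :
    A = 0 := by
  obtain ⟨eA, h₁, h₂⟩ := mem_lieAlgebraGL_graphGroup_weight eX eX' hTm.2.1 hTm'.2.1 h h' hA hw
  rw [h.lieWeightSpace_charOfWeight_eq_bot hG hTm hx0 hx, Submodule.mem_bot] at h₁
  rw [h'.lieWeightSpace_charOfWeight_eq_bot hG' hTm' hx0 hx, Submodule.mem_bot] at h₂
  rw [eA, h₁, h₂, fromBlocks_zero]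

end Weights

/-! ### The Lie subalgebra `𝔡_S` generated by `Lie(T̃)`, `ẽ_i`, `f̃_i` and its normaliser -/

section LieGen

variable [IsAlgClosed k] (h : IsRootDatumOf G T P eX eY) (h' : IsRootDatumOf G' T' P eX' eY')
  (hT : IsTorusSubgroup T) (hT' : IsTorusSubgroup T')

/-- The generating set of `𝔡_S`: `Lie(T̃)` and the diagonal root vectors `ẽ_i`, `f̃_i`, `i ∈ S`.
[folklore] -/
def graphLieGenSet (S : Set ι) : Set (Matrix (n ⊕ n') (n ⊕ n') k) :=
  (lieAlgebraGL (graphTorus eX eX' hT hT') : Set (Matrix (n ⊕ n') (n ⊕ n') k)) ∪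
    ((fun i => graphE h h' i) '' S ∪ (fun i => graphF h h' i) '' S)

/-- **The Lie subalgebra `𝔡_S ⊆ 𝔤𝔩_{n+n'}` generated by `Lie(T̃)` and the `ẽ_i`, `f̃_i`, `i ∈ S`**
(commutator bracket). [folklore] -/
def graphLieGen (S : Set ι) : LieSubalgebra k (Matrix (n ⊕ n') (n ⊕ n') k) :=
  LieSubalgebra.lieSpan k _ (graphLieGenSet h h' hT hT' S)

variable (S : Set ι)

/-- `Lie(T̃) ⊆ 𝔡_S`. [folklore] -/
theorem lieAlgebraGL_graphTorus_le_graphLieGen :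
    lieAlgebraGL (graphTorus eX eX' hT hT') ≤ (graphLieGen h h' hT hT' S).toSubmodule := fun _ hA =>
  LieSubalgebra.subset_lieSpan (Or.inl hA)

/-- `ẽ_i ∈ 𝔡_S` for `i ∈ S`. [folklore] -/
theorem graphE_mem_graphLieGen {i : ι} (hi : i ∈ S) : graphE h h' i ∈ graphLieGen h h' hT hT' S :=
  LieSubalgebra.subset_lieSpan (Or.inr (Or.inl ⟨i, hi, rfl⟩))

/-- `f̃_i ∈ 𝔡_S` for `i ∈ S`. [folklore] -/
theorem graphF_mem_graphLieGen {i : ι} (hi : i ∈ S) : graphF h h' i ∈ graphLieGen h h' hT hT' S :=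
  LieSubalgebra.subset_lieSpan (Or.inr (Or.inr ⟨i, hi, rfl⟩))

variable [Infinite k]

/-- `h̃_i ∈ 𝔡_S` (it lies in `Lie(T̃)`). [folklore] -/
theorem graphHc_mem_graphLieGen (i : ι) : graphHc h h' i ∈ graphLieGen h h' hT hT' S :=
  lieAlgebraGL_graphTorus_le_graphLieGen h h' hT hT' S (graphHc_mem_lieAlgebraGL_graphTorus h h' hT hT' i)

/-- **`𝔡_S ⊆ Lie(H_S)`** (`Lie(H_S)` is a Lie subalgebra containing the generators). [folklore] -/
theorem graphLieGen_le : (graphLieGen h h' hT hT' S).toSubmodule ≤ lieAlgebraGL (graphGroup h h' hT hT' S) := by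
  change graphLieGen h h' hT hT' S ≤ lieSubalgebraGL (graphGroup h h' hT hT' S)
  rw [graphLieGen, LieSubalgebra.lieSpan_le]
  rintro A (hA | ⟨i, hi, rfl⟩ | ⟨i, hi, rfl⟩)
  · exact lieAlgebraGL_mono (graphTorus_le_graphGroup h h' hT hT' S) hA
  · exact graphE_mem_lieAlgebraGL_graphGroup h h' hT hT' hi
  · exact graphF_mem_lieAlgebraGL_graphGroup h h' hT hT' hi

omit [IsAlgClosed k] [Infinite k] in
/-- Conjugation by an invertible matrix preserves a Lie subalgebra generated by a set as soon as it
maps the set into the subalgebra (conjugation is a Lie algebra automorphism of `𝔤𝔩`; proof by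
`lieSpan_induction`). [folklore] -/
theorem conj_mem_lieSpan_of_forall {m : Type*} [Fintype m] [DecidableEq m] {s : Set (Matrix m m k)}
    (g : GL m k) (hs : ∀ M ∈ s, (g : Matrix m m k) * M * ((g⁻¹ : GL m k) : Matrix m m k) ∈ LieSubalgebra.lieSpan k _ s)
    {M : Matrix m m k} (hM : M ∈ LieSubalgebra.lieSpan k _ s) :
    (g : Matrix m m k) * M * ((g⁻¹ : GL m k) : Matrix m m k) ∈ LieSubalgebra.lieSpan k _ s := by
  induction hM using LieSubalgebra.lieSpan_induction with
  | mem x hx => exact hs x hx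
  | zero => simp
  | add x y _ _ hx hy => rw [Matrix.mul_add, Matrix.add_mul]; exact add_mem hx hy
  | smul a x _ hx => rw [Matrix.mul_smul, Matrix.smul_mul]; exact SMulMemClass.smul_mem a hx
  | lie x y _ _ hx hy =>
    have hg : ((g⁻¹ : GL m k) : Matrix m m k) * (g : Matrix m m k) = 1 := Units.inv_mul g
    have e : ∀ a b : Matrix m m k,
        (g : Matrix m m k) * a * ((g⁻¹ : GL m k) : Matrix m m k) *
            ((g : Matrix m m k) * b * ((g⁻¹ : GL m k) : Matrix m m k)) =
          (g : Matrix m m k) * (a * b) * ((g⁻¹ : GL m k) : Matrix m m k) := fun a b => by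
      simp only [Matrix.mul_assoc]
      rw [← Matrix.mul_assoc ((g⁻¹ : GL m k) : Matrix m m k) (g : Matrix m m k), hg, Matrix.one_mul]
    have key : (g : Matrix m m k) * ⁅x, y⁆ * ((g⁻¹ : GL m k) : Matrix m m k) =
        ⁅(g : Matrix m m k) * x * ((g⁻¹ : GL m k) : Matrix m m k),
          (g : Matrix m m k) * y * ((g⁻¹ : GL m k) : Matrix m m k)⁆ := by
      rw [Ring.lie_def, Ring.lie_def, e, e, Matrix.mul_sub, Matrix.sub_mul]
    rw [key]
    exact LieSubalgebra.lie_mem _ hx hy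

omit [IsAlgClosed k] [Infinite k] in
/-- Conjugation-stability of a subspace under a supremum of two subgroups follows from that under
each (induction on the generated subgroup; inverses are taken inside the generating subgroups).
[folklore] -/
theorem conj_mem_of_mem_sup {m : Type*} [Fintype m] [DecidableEq m] {H K : Subgroup (GL m k)}
    {L : Submodule k (Matrix m m k)}
    (hH : ∀ g ∈ H, ∀ M ∈ L, (g : Matrix m m k) * M * ((g⁻¹ : GL m k) : Matrix m m k) ∈ L)
    (hK : ∀ g ∈ K, ∀ M ∈ L, (g : Matrix m m k) * M * ((g⁻¹ : GL m k) : Matrix m m k) ∈ L)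
    {g : GL m k} (hg : g ∈ H ⊔ K) :
    ∀ M ∈ L, (g : Matrix m m k) * M * ((g⁻¹ : GL m k) : Matrix m m k) ∈ L := by
  rw [sup_eq_iSup] at hg
  refine Subgroup.iSup_induction _ (C := fun g : GL m k =>
    ∀ M ∈ L, (g : Matrix m m k) * M * ((g⁻¹ : GL m k) : Matrix m m k) ∈ L) hg ?_ ?_ ?_
  · rintro (_ | _) x hx
    · exact hK x hx
    · exact hH x hx
  · intro M hM; simpa using hM
  · intro x y hx hy M hM
    rw [_root_.mul_inv_rev, Units.val_mul, Units.val_mul]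
    have := hx _ (hy M hM)
    simpa only [Matrix.mul_assoc] using this

omit [IsAlgClosed k] [Infinite k] in
/-- Conjugation-stability of a subspace under a supremum of subgroups follows from that under each.
[folklore] -/
theorem conj_mem_of_mem_iSup {m : Type*} [Fintype m] [DecidableEq m] {κ : Sort*} {H : κ → Subgroup (GL m k)}
    {L : Submodule k (Matrix m m k)}
    (hH : ∀ j, ∀ g ∈ H j, ∀ M ∈ L, (g : Matrix m m k) * M * ((g⁻¹ : GL m k) : Matrix m m k) ∈ L)
    {g : GL m k} (hg : g ∈ ⨆ j, H j) :
    ∀ M ∈ L, (g : Matrix m m k) * M * ((g⁻¹ : GL m k) : Matrix m m k) ∈ L := by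
  refine Subgroup.iSup_induction _ (C := fun g : GL m k =>
    ∀ M ∈ L, (g : Matrix m m k) * M * ((g⁻¹ : GL m k) : Matrix m m k) ∈ L) hg hH ?_ ?_
  · intro M hM; simpa using hM
  · intro x y hx hy M hM
    rw [_root_.mul_inv_rev, Units.val_mul, Units.val_mul]
    have := hx _ (hy M hM)
    simpa only [Matrix.mul_assoc] using this

/-- **`Ad t̃` preserves `𝔡_S` for `t̃ ∈ T̃`**: it fixes `Lie(T̃)` (`T̃` is commutative) and scales the
weight vectors `ẽ_i`, `f̃_i`. [folklore] -/
theorem conj_mem_graphLieGen_of_mem_graphTorus {s : GL (n ⊕ n') k} (hs : s ∈ graphTorus eX eX' hT hT')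
    {M : Matrix (n ⊕ n') (n ⊕ n') k} (hM : M ∈ graphLieGen h h' hT hT' S) :
    (s : Matrix _ _ k) * M * ((s⁻¹ : GL (n ⊕ n') k) : Matrix _ _ k) ∈ graphLieGen h h' hT hT' S := by
  haveI : IsMulCommutative ↥(graphTorus eX eX' hT hT') := isMulCommutative_graphTorus eX eX' hT hT'
  refine conj_mem_lieSpan_of_forall s ?_ hM
  rintro A (hA | ⟨i, hi, rfl⟩ | ⟨i, hi, rfl⟩)
  · rw [conj_eq_self_of_mem_lieAlgebraGL hA ⟨s, hs⟩]
    exact LieSubalgebra.subset_lieSpan (Or.inl hA)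
  · have e := graphE_mem_weightSpaceGL h h' hT hT' i ⟨s, hs⟩
    change (s : Matrix _ _ k) * graphE h h' i * _ ∈ _
    rw [Matrix.coe_units_inv, e]
    exact (graphLieGen h h' hT hT' S).smul_mem _ (graphE_mem_graphLieGen h h' hT hT' S hi)
  · have e := graphF_mem_weightSpaceGL h h' hT hT' i ⟨s, hs⟩
    change (s : Matrix _ _ k) * graphF h h' i * _ ∈ _
    rw [Matrix.coe_units_inv, e]
    exact (graphLieGen h h' hT hT' S).smul_mem _ (graphF_mem_graphLieGen h h' hT hT' S hi)

variable [CharZero k] (hG : IsAlgebraicSubgroup G) (hG' : IsAlgebraicSubgroup G')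

include hG hG' in
/-- **`Ad ũ_i(x)` preserves `𝔡_S` for `i ∈ S`**: `ũ_i(x) = exp (x ẽ_i)` and `ad ẽ_i` preserves
`𝔡_S` (`expHom_conj_mem`, Springer 4.4.15 / 10.2.8). [cite: SpringerLAG1998, 10.2.8] -/
theorem conj_mem_graphLieGen_graphUpperGL {i : ι} (hi : i ∈ S) (x : Multiplicative k)
    {M : Matrix (n ⊕ n') (n ⊕ n') k} (hM : M ∈ graphLieGen h h' hT hT' S) :
    ((graphUpperGL h h' i x : GL (n ⊕ n') k) : Matrix _ _ k) * M *
        (((graphUpperGL h h' i x)⁻¹ : GL (n ⊕ n') k) : Matrix _ _ k) ∈ graphLieGen h h' hT hT' S := by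
  have ex : x = Multiplicative.ofAdd (Multiplicative.toAdd x) := rfl
  rw [ex, graphUpperGL_eq_expHom h h' hT hT' hG hG']
  refine expHom_conj_mem (L := (graphLieGen h h' hT hT' S).toSubmodule) (isNilpotent_graphE h h' hT hT' i)
    (fun M' hM' => ?_) hM _
  exact (graphLieGen h h' hT hT' S).lie_mem (graphE_mem_graphLieGen h h' hT hT' S hi) hM'

include hG hG' in
/-- **`Ad ṽ_i(x)` preserves `𝔡_S` for `i ∈ S`.** [cite: SpringerLAG1998, 10.2.8] -/
theorem conj_mem_graphLieGen_graphLowerGL {i : ι} (hi : i ∈ S) (x : Multiplicative k)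
    {M : Matrix (n ⊕ n') (n ⊕ n') k} (hM : M ∈ graphLieGen h h' hT hT' S) :
    ((graphLowerGL h h' i x : GL (n ⊕ n') k) : Matrix _ _ k) * M *
        (((graphLowerGL h h' i x)⁻¹ : GL (n ⊕ n') k) : Matrix _ _ k) ∈ graphLieGen h h' hT hT' S := by
  have ex : x = Multiplicative.ofAdd (Multiplicative.toAdd x) := rfl
  rw [ex, graphLowerGL_eq_expHom h h' hT hT' hG hG']
  refine expHom_conj_mem (L := (graphLieGen h h' hT hT' S).toSubmodule) (isNilpotent_graphF h h' hT hT' i)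
    (fun M' hM' => ?_) hM _
  exact (graphLieGen h h' hT hT' S).lie_mem (graphF_mem_graphLieGen h h' hT hT' S hi) hM'

include hG hG' in
/-- **`H_S` normalises `𝔡_S`**: every element of `H_S` conjugates `𝔡_S` into itself (the
generators do, and these form a subgroup; induction on the generated subgroup).
[cite: SpringerLAG1998, 10.2.8] -/
theorem conj_mem_graphLieGen {g : GL (n ⊕ n') k} (hg : g ∈ graphGroup h h' hT hT' S)
    {M : Matrix (n ⊕ n') (n ⊕ n') k} (hM : M ∈ graphLieGen h h' hT hT' S) :
    (g : Matrix _ _ k) * M * ((g⁻¹ : GL (n ⊕ n') k) : Matrix _ _ k) ∈ graphLieGen h h' hT hT' S := by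
  refine conj_mem_of_mem_sup (L := (graphLieGen h h' hT hT' S).toSubmodule) ?_ ?_ hg M hM
  · intro s hs M hM
    exact conj_mem_graphLieGen_of_mem_graphTorus h h' hT hT' S hs hM
  · intro u hu
    refine conj_mem_of_mem_iSup (L := (graphLieGen h h' hT hT' S).toSubmodule) (fun i => ?_) hu
    rintro v hv
    refine conj_mem_of_mem_sup (L := (graphLieGen h h' hT hT' S).toSubmodule) ?_ ?_ hv
    · rintro _ ⟨x, rfl⟩ M hM
      exact conj_mem_graphLieGen_graphUpperGL h h' hT hT' S hG hG' i.2 x hM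
    · rintro _ ⟨x, rfl⟩ M hM
      exact conj_mem_graphLieGen_graphLowerGL h h' hT hT' S hG hG' i.2 x hM

include hG hG' in
/-- **`[Lie(H_S), 𝔡_S] ⊆ 𝔡_S`**: the Lie algebra of `H_S` normalises what `H_S` normalises
(`lie_mem_of_forall_conj_mem`, Springer 4.4.15). [cite: SpringerLAG1998, 4.4.15] -/
theorem lie_mem_graphLieGen_of_mem_lieAlgebraGL {A : Matrix (n ⊕ n') (n ⊕ n') k}
    (hA : A ∈ lieAlgebraGL (graphGroup h h' hT hT' S)) {M : Matrix (n ⊕ n') (n ⊕ n') k}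
    (hM : M ∈ graphLieGen h h' hT hT' S) : A * M - M * A ∈ graphLieGen h h' hT hT' S :=
  lie_mem_of_forall_conj_mem (L := (graphLieGen h h' hT hT' S).toSubmodule)
    (fun _ hg _ hM' => conj_mem_graphLieGen h h' hT hT' S hG hG' hg hM') hA hM

include hG hG' in
/-- The Weyl elements `ñ_i`, `i ∈ S`, conjugate `𝔡_S` onto itself. [folklore] -/
theorem conj_mem_graphLieGen_graphWeyl {i : ι} (hi : i ∈ S) {M : Matrix (n ⊕ n') (n ⊕ n') k}
    (hM : M ∈ graphLieGen h h' hT hT' S) :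
    ((graphWeyl h h' i : GL (n ⊕ n') k) : Matrix _ _ k) * M *
        (((graphWeyl h h' i)⁻¹ : GL (n ⊕ n') k) : Matrix _ _ k) ∈ graphLieGen h h' hT hT' S :=
  conj_mem_graphLieGen h h' hT hT' S hG hG' (graphWeyl_mem_graphGroup h h' hT hT' S hi) hM

end LieGen

end Literature.NumberTheory.Automorphic

end
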